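import Summits.Parity.GeneralizedHardyLittlewood.Theorems.LeeYangFibresRelativeDimOneSplitCosetCount
import Summits.Parity.GeneralizedHardyLittlewood.Theorems.LeeYangFibresRelativeDimOneSplitTranslation
import HarnessLib

/-!
# Degenerate shifts in a box-coset are few (crux stmt-Parity-14113 `LeeYangFibres.RelativeDimOne`,
line gallagher-backwards-split, stub `stub_inversion`, PIECE 3c)

`sys a b` (all `a_i ≠ 0`) is degenerate iff some discriminant `a_i b_k − a_k b_i` (`i ≠ k`) vanishes
(`isNondegenerateSystem_sys_iff`). On the coset `C = ∏_i C_i` of a box, for fixed `i ≠ k` the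
`k`-th coordinate of such a shift is determined by the `i`-th, so these shifts number at most
`∏_{j ≠ k} #C_j` (`card_coset_filter_disc_le`); summing over pairs,
`#{b ∈ C : sys a b degenerate} ≤ t Σ_k ∏_{j ≠ k} #C_j ≤ t² 2^t (q/D) ∏_i (X_i+1)/q^t` when
`q ≤ D ≤ X_i + 1` (`card_coset_degenerate_le`, `card_coset_degenerate_le_real`).
-/

noncomputable section

open scoped BigOperators Classical Topology
open Finset Filter MeasureTheory Literature.NumberTheory.Sieve

namespace Summit.Parity.GeneralizedHardyLittlewood.Cruxes.RelativeDimOne.GallagherBackwardsSplit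

variable {t : ℕ}

/-- For `i ≠ k` and `a_i ≠ 0`, the shifts `b` of the box-coset with `a_i b_k = a_k b_i` number at most
`∏_j (j = k ? 1 : #C_j)`: freezing the `k`-th coordinate is injective on them. -/
theorem card_coset_filter_disc_le (u c : Fin t → ℤ) (X : Fin t → ℕ) (q : ℕ) (a : Fin t → ℤ)
    {i k : Fin t} (hik : i ≠ k) (hai : a i ≠ 0) :
    (((box u X).filter (fun b => ∀ j, Int.ModEq q (b j) (c j))).filter
        (fun b => a i * b k = a k * b i)).card ≤
      ∏ j, (if j = k then 1 else ((Icc (u j) (u j + X j)).filter (fun x => Int.ModEq q x (c j))).card) := by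
  set T : Finset (Fin t → ℤ) := Fintype.piFinset fun j =>
    if j = k then ({u k} : Finset ℤ) else (Icc (u j) (u j + X j)).filter (fun x => Int.ModEq q x (c j))
    with hT
  have hcardT : T.card = ∏ j, (if j = k then 1 else
      ((Icc (u j) (u j + X j)).filter (fun x => Int.ModEq q x (c j))).card) := by
    rw [hT, Fintype.card_piFinset]
    refine Finset.prod_congr rfl fun j _ => ?_
    by_cases hj : j = k
    · subst hj; simp
    · simp [hj]
  rw [← hcardT]
  refine Finset.card_le_card_of_injOn (fun b => Function.update b k (u k)) ?_ ?_
  · intro b hb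
    rw [Finset.mem_coe, Finset.mem_filter, Finset.mem_filter, box, Fintype.mem_piFinset] at hb
    rw [Finset.mem_coe, hT, Fintype.mem_piFinset]
    intro j
    by_cases hj : j = k
    · subst hj
      simp
    · rw [if_neg hj]
      show Function.update b k (u k) j ∈ _
      rw [Function.update_of_ne hj, Finset.mem_filter]
      exact ⟨hb.1.1 j, hb.1.2 j⟩
  · intro b hb b' hb' heq
    rw [Finset.mem_coe, Finset.mem_filter] at hb hb'
    have hj : ∀ j, j ≠ k → b j = b' j := by
      intro j hj
      have := congrFun heq j
      dsimp only at this
      rwa [Function.update_of_ne hj, Function.update_of_ne hj] at this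
    have hbi : b i = b' i := hj i hik
    have hbk : b k = b' k := by
      apply mul_left_cancel₀ hai
      rw [hb.2, hb'.2, hbi]
    funext j
    by_cases hjk : j = k
    · rw [hjk]; exact hbk
    · exact hj j hjk

/-- The degenerate shifts of a box-coset number at most `t Σ_k ∏_j (j = k ? 1 : #C_j)`. -/
theorem card_coset_degenerate_le (u c : Fin t → ℤ) (X : Fin t → ℕ) (q : ℕ) (a : Fin t → ℤ)
    (ha : ∀ i, a i ≠ 0) :
    (((box u X).filter (fun b => ∀ j, Int.ModEq q (b j) (c j))).filter
        (fun b => ¬ IsNondegenerateSystem (sys a b))).card ≤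
      t * ∑ k, ∏ j, (if j = k then 1 else
        ((Icc (u j) (u j + X j)).filter (fun x => Int.ModEq q x (c j))).card) := by
  set C := (box u X).filter (fun b => ∀ j, Int.ModEq q (b j) (c j)) with hC
  have hsub : C.filter (fun b => ¬ IsNondegenerateSystem (sys a b)) ⊆
      (Finset.univ : Finset (Fin t)).biUnion fun k => (Finset.univ : Finset (Fin t)).biUnion fun i =>
        C.filter (fun b => i ≠ k ∧ a i * b k = a k * b i) := by
    intro b hb
    rw [Finset.mem_filter, isNondegenerateSystem_sys_iff] at hb
    obtain ⟨hbC, hdeg⟩ := hb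
    have : ∃ i k, i ≠ k ∧ a i * b k = a k * b i := by
      by_contra hcon
      exact hdeg ⟨ha, fun i j hij hD => hcon ⟨i, j, hij, hD⟩⟩
    obtain ⟨i, k, hik, hD⟩ := this
    simp only [Finset.mem_biUnion, Finset.mem_univ, true_and, Finset.mem_filter]
    exact ⟨k, i, hbC, hik, hD⟩
  calc (C.filter (fun b => ¬ IsNondegenerateSystem (sys a b))).card
      ≤ ((Finset.univ : Finset (Fin t)).biUnion fun k => (Finset.univ : Finset (Fin t)).biUnion fun i =>
          C.filter (fun b => i ≠ k ∧ a i * b k = a k * b i)).card := Finset.card_le_card hsub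
    _ ≤ ∑ k, ((Finset.univ : Finset (Fin t)).biUnion fun i =>
          C.filter (fun b => i ≠ k ∧ a i * b k = a k * b i)).card := Finset.card_biUnion_le
    _ ≤ ∑ k, ∑ i, (C.filter (fun b => i ≠ k ∧ a i * b k = a k * b i)).card :=
        Finset.sum_le_sum fun k _ => Finset.card_biUnion_le
    _ ≤ ∑ k, ∑ _i : Fin t, ∏ j, (if j = k then 1 else
          ((Icc (u j) (u j + X j)).filter (fun x => Int.ModEq q x (c j))).card) := by
        refine Finset.sum_le_sum fun k _ => Finset.sum_le_sum fun i _ => ?_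
        by_cases hik : i = k
        · have : C.filter (fun b => i ≠ k ∧ a i * b k = a k * b i) = ∅ := by
            refine Finset.filter_false_of_mem fun b _ => ?_
            rw [not_and_or, not_not]
            exact Or.inl hik
          rw [this, Finset.card_empty]
          exact Nat.zero_le _
        · calc (C.filter (fun b => i ≠ k ∧ a i * b k = a k * b i)).card
              = (C.filter (fun b => a i * b k = a k * b i)).card := by
                congr 1
                exact Finset.filter_congr fun b _ => ⟨fun h => h.2, fun h => ⟨hik, h⟩⟩
            _ ≤ _ := card_coset_filter_disc_le u c X q a hik (ha i)
    _ = t * ∑ k, ∏ j, (if j = k then 1 else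
          ((Icc (u j) (u j + X j)).filter (fun x => Int.ModEq q x (c j))).card) := by
        rw [Finset.sum_comm]
        simp [Finset.sum_const, Finset.card_univ, Fintype.card_fin]

/-- `∏_j (j = k ? 1 : g j) = ∏_{j ≠ k} g j`. -/
theorem prod_ite_eq_one_eq_prod_erase {M : Type*} [CommMonoid M] (g : Fin t → M) (k : Fin t) :
    ∏ j, (if j = k then 1 else g j) = ∏ j ∈ Finset.univ.erase k, g j := by
  rw [← Finset.filter_ne', Finset.prod_filter]
  refine Finset.prod_congr rfl fun j _ => ?_
  by_cases h : j = k <;> simp [h]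

/-- Real form: `#{b ∈ C : sys a b degenerate} ≤ t² 2^t (q/D) ∏_i (X_i+1)/q^t` whenever
`1 ≤ q ≤ D ≤ X_i + 1`. -/
theorem card_coset_degenerate_le_real {q : ℕ} (hq : 0 < q) (u c : Fin t → ℤ) (X : Fin t → ℕ)
    (a : Fin t → ℤ) (ha : ∀ i, a i ≠ 0) {D : ℝ} (hqD : (q : ℝ) ≤ D) (hD : ∀ i, D ≤ (X i : ℝ) + 1) :
    (((((box u X).filter (fun b => ∀ j, Int.ModEq q (b j) (c j))).filter
        (fun b => ¬ IsNondegenerateSystem (sys a b))).card : ℕ) : ℝ) ≤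
      t * t * 2 ^ t * ((q : ℝ) / D) * ((∏ i, ((X i : ℝ) + 1)) / (q : ℝ) ^ t) := by
  have hq0 : (0 : ℝ) < q := by exact_mod_cast hq
  have hD0 : 0 < D := lt_of_lt_of_le hq0 hqD
  set x : Fin t → ℝ := fun j => ((X j : ℝ) + 1) / q with hx
  have hx1 : ∀ j, 1 ≤ x j := fun j => by
    rw [hx]; dsimp only; rw [one_le_div hq0]; linarith [hD j]
  have hprod : (∏ i, ((X i : ℝ) + 1)) / (q : ℝ) ^ t = ∏ j, x j := by
    rw [hx, Finset.prod_div_distrib, Finset.prod_const, Finset.card_univ, Fintype.card_fin]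
  set n : Fin t → ℕ := fun j => ((Icc (u j) (u j + X j)).filter (fun y => Int.ModEq q y (c j))).card
    with hn
  have hnx : ∀ j, (n j : ℝ) ≤ 2 * x j := by
    intro j
    have := (card_Icc_filter_modEq_bounds hq (u j) (c j) (X j)).2
    have h1 := hx1 j
    rw [hx] at h1 ⊢; dsimp only at h1 ⊢
    rw [hn]; dsimp only
    linarith
  -- each `k`-term
  have hterm : ∀ k, ((∏ j, (if j = k then 1 else n j) : ℕ) : ℝ) ≤ 2 ^ t * ((q : ℝ) / D) * ∏ j, x j := by
    intro k
    have h1 : ((∏ j, (if j = k then 1 else n j) : ℕ) : ℝ) = ∏ j, (if j = k then (1 : ℝ) else (n j : ℝ)) := by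
      rw [Nat.cast_prod]
      refine Finset.prod_congr rfl fun j _ => ?_
      split_ifs <;> simp
    rw [h1, prod_ite_eq_one_eq_prod_erase, ← Finset.mul_prod_erase Finset.univ x (Finset.mem_univ k)]
    have h2 : ∏ j ∈ Finset.univ.erase k, (n j : ℝ) ≤ ∏ j ∈ Finset.univ.erase k, (2 * x j) :=
      Finset.prod_le_prod (fun j _ => Nat.cast_nonneg _) fun j _ => hnx j
    have h3 : ∏ j ∈ Finset.univ.erase k, (2 * x j) = 2 ^ (t - 1) * ∏ j ∈ Finset.univ.erase k, x j := by
      rw [Finset.prod_mul_distrib, Finset.prod_const, Finset.card_erase_of_mem (Finset.mem_univ k),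
        Finset.card_univ, Fintype.card_fin]
    have hP : 0 ≤ ∏ j ∈ Finset.univ.erase k, x j :=
      Finset.prod_nonneg fun j _ => le_trans zero_le_one (hx1 j)
    have h4 : (2 : ℝ) ^ (t - 1) ≤ 2 ^ t := pow_le_pow_right₀ (by norm_num) (Nat.sub_le t 1)
    have h5 : 1 ≤ ((q : ℝ) / D) * x k := by
      rw [hx]; dsimp only
      rw [div_mul_div_comm, one_le_div (by positivity)]
      nlinarith [hD k, hq0]
    calc ∏ j ∈ Finset.univ.erase k, (n j : ℝ) ≤ 2 ^ (t - 1) * ∏ j ∈ Finset.univ.erase k, x j := by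
          rw [← h3]; exact h2
      _ ≤ 2 ^ t * 1 * ∏ j ∈ Finset.univ.erase k, x j := by
          rw [mul_one]; exact mul_le_mul_of_nonneg_right h4 hP
      _ ≤ 2 ^ t * (((q : ℝ) / D) * x k) * ∏ j ∈ Finset.univ.erase k, x j := by
          gcongr
      _ = 2 ^ t * ((q : ℝ) / D) * (x k * ∏ j ∈ Finset.univ.erase k, x j) := by ring
  have hnat := card_coset_degenerate_le u c X q a ha
  have hcast : (((((box u X).filter (fun b => ∀ j, Int.ModEq q (b j) (c j))).filter
      (fun b => ¬ IsNondegenerateSystem (sys a b))).card : ℕ) : ℝ) ≤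
      t * ∑ k, ((∏ j, (if j = k then 1 else n j) : ℕ) : ℝ) := by
    exact_mod_cast hnat
  refine le_trans hcast ?_
  rw [hprod]
  calc (t : ℝ) * ∑ k, ((∏ j, (if j = k then 1 else n j) : ℕ) : ℝ)
      ≤ t * ∑ _k : Fin t, 2 ^ t * ((q : ℝ) / D) * ∏ j, x j := by
        gcongr with k
        exact hterm k
    _ = t * t * 2 ^ t * ((q : ℝ) / D) * ∏ j, x j := by
        rw [Finset.sum_const, Finset.card_univ, Fintype.card_fin, nsmul_eq_mul]; ring

/-- Registered form of `card_coset_degenerate_le_real` (aux for `stub_inversion`). -/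
theorem coset_degenerate_count : ∀ {t : ℕ} (q : ℕ), 0 < q → ∀ (u c : Fin t → ℤ) (X : Fin t → ℕ) (a : Fin t → ℤ), (∀ i, a i ≠ 0) → ∀ (D : ℝ), (q : ℝ) ≤ D → (∀ i, D ≤ (X i : ℝ) + 1) → (((((box u X).filter (fun b => ∀ j, Int.ModEq q (b j) (c j))).filter (fun b => ¬ IsNondegenerateSystem (sys a b))).card : ℕ) : ℝ) ≤ t * t * 2 ^ t * ((q : ℝ) / D) * ((∏ i, ((X i : ℝ) + 1)) / (q : ℝ) ^ t) :=
  fun _ hq u c X a ha _ hqD hD => card_coset_degenerate_le_real hq u c X a ha hqD hD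

end Summit.Parity.GeneralizedHardyLittlewood.Cruxes.RelativeDimOne.GallagherBackwardsSplit
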